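import Mathlib
import HarnessLib
import Summits.NavierStokesRegularity.NavierStokesRegularity.Theorems.UnthreadedRigidityDoorUnthreadedRigidityVirialHornTwoChannelEuler
import Summits.NavierStokesRegularity.NavierStokesRegularity.Theorems.UnthreadedRigidityDoorUnthreadedRigidityThreadingJetsSlice

/-!
# Route `UnthreadedRigidityDoor`, item `UnthreadedRigidity` (W2, stmt-NavierStokesRegularity-27585) — LINE g11-1 «VIRIAL HORN»,
# BRIDGE V for PLATEAU PROFILES («TWO-CHANNEL RIGIDITY»), file 7: THE TWO CHANNEL EQUATIONS AND THE KEY ALGEBRA `l·ampA² + 2s·ampA·ampA′ = 0`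

Prover file (W2 Lean hand ns-crc-p1 g10, by lineage; `--supports stmt-NavierStokesRegularity-27585 --as helper`; objects BY NAME in
`Theorems/UnthreadedRigidityDoorUnthreadedRigidityVirialHornTwoChannelDefs.lean`, p726708 / p728780 and its second append).

Content: ★ `twoChannel_euler_eqs` — under the hypotheses of the slice law ((F2) `VirialHorn.orderTwoLawSlice_holds`, crc-p2 g8; the
pressure bracket of file 5) and `TwoChannel l Y`, at every radius `r > 0` with `K(r) ≠ 0`: (E1) `ampA(r²)²/2 = 2r²g₁′(r²) + (2l−2)g₁(r²)`,
(E2) `2r²g₂′(r²) + (2l−4)g₂(r²) = 0`; `contDiffOn_profile_Ioi`, `continuousOn_vortAmpL`; ★ `ampA_ode_of_channels`: on an interval of `s`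
the two equations and the level-two radial ODE force `l·ampA(s)² + 2s·ampA(s)·ampA′(s) = 0` (differentiate (E2), eliminate `g₁`,
differentiate, substitute into (E1) — the `g`'s cancel; one `linear_combination`).
HONEST LABEL: slice-level calculus / real analysis about SPECIAL (separable) data; a piece of the L-part of ONE bridge of a RUNG line on the
wall item; `UnthreadedRigidity` (27585), W2 and NS regularity remain OPEN; nothing here is a statement about Navier–Stokes regularity.  0 kit.
-/

-- the summit and its single sub-problem share the name (CONVENTIONS §1), as in every Theorems file
set_option linter.dupNamespace false

namespace Summit.NavierStokesRegularity.NavierStokesRegularity.Theorems.UnthreadedRigidity.VirialHorn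

open scoped RealInnerProductSpace Topology Laplacian
open Filter Set MvPolynomial
open Literature.Combinatorics.LorentzianPolynomials (pderiv_pderiv_comm)
open Summit.NavierStokesRegularity.NavierStokesRegularity.Theorems.UnthreadedRigidity.ProfileHorn (E3)
open Summit.NavierStokesRegularity.NavierStokesRegularity.Theorems.UnthreadedRigidity.HornPressure (radCoeff)
open Summit.NavierStokesRegularity.NavierStokesRegularity.Theorems.PoloidalLiouville.HorizonTower hiding E3

/-! ## §8 TWO-CHANNEL RIGIDITY: the channel equations, the local families, the gluing, the theorems -/

section Rigidity

open scoped ContDiff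
open MeasureTheory Literature.Analysis.FluidPDE

variable {l : ℕ} {P : MvPolynomial (Fin 3) ℝ} {H h : ℝ → ℝ} {C : ℝ} {x₀ : E3} {p₀ : E3 → ℝ}

/-- ★ THE TWO CHANNEL EQUATIONS.  Under the hypotheses of the slice law (separable degree-`l` shell, decaying slice pressure, vanishing
formal second jet) and `TwoChannel l Y`, at every radius `r > 0` with `K(r) ≠ 0`:
`(E1) ampA(r²)²/2 = 2r² g₁′(r²) + (2l−2) g₁(r²)`, `(E2) 2r² g₂′(r²) + (2l−4) g₂(r²) = 0` (`g_k = cascadeCoeff l h k`). -/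
theorem twoChannel_euler_eqs (hl : 3 ≤ l) (hP : P.IsHomogeneous l) (hlap : Zonal.lapP P = 0)
    (h2 : TwoChannel l (Zonal.evalE P)) (hH : VirialAdmissible l H)
    (hh : ContDiff ℝ ∞ h) (hHh : ∀ r : ℝ, 0 ≤ r → H r = h (r ^ 2))
    (hC : ∀ r : ℝ, 1 ≤ r → r ^ (l + 2) * |H r| ≤ C ∧ r ^ (l + 3) * |deriv H r| ≤ C ∧ r ^ (l + 4) * |deriv (deriv H) r| ≤ C)
    (hsm : ContDiff ℝ (⊤ : ℕ∞) (sepShellL H (Zonal.evalE P) x₀))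
    (hdiv : VectorCalculus.IsDivFree (sepShellL H (Zonal.evalE P) x₀))
    (hp : ContDiff ℝ (⊤ : ℕ∞) p₀)
    (hpoi : ∀ x : E3, (Δ p₀) x =
      -VectorCalculus.divergence (convect (sepShellL H (Zonal.evalE P) x₀) (sepShellL H (Zonal.evalE P) x₀)) x)
    (hdec : Tendsto p₀ (cocompact E3) (𝓝 0))
    (hj : ∀ x : E3, ThreadingJets.fluxJetTwo (sepShellL H (Zonal.evalE P) x₀) p₀ x₀ x = 0)
    {r : ℝ} (hr : 0 < r) (hK : vortAmpL l H r ≠ 0) :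
    ampA l h (r ^ 2) ^ 2 / 2 - (2 * r ^ 2 * deriv (cascadeCoeff l h 1) (r ^ 2)
        + ((2 * l - 2 * 1 : ℕ) : ℝ) * cascadeCoeff l h 1 (r ^ 2)) = 0 ∧
    2 * r ^ 2 * deriv (cascadeCoeff l h 2) (r ^ 2) + ((2 * l - 2 * 2 : ℕ) : ℝ) * cascadeCoeff l h 2 (r ^ 2) = 0 := by
  set Y := Zonal.evalE P with hYdef
  have hY : IsSolidHarmonic l Y := isSolidHarmonic_evalE hP hlap
  have hl1 : 1 ≤ l := by omega
  set e : ℕ → ℝ := fun k => 2 * r ^ 2 * deriv (cascadeCoeff l h k) (r ^ 2)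
    + ((2 * l - 2 * k : ℕ) : ℝ) * cascadeCoeff l h k (r ^ 2) with he
  set θ : ℕ → ℝ := fun k => (if k = 1 then ampA l h (r ^ 2) ^ 2 / 2 else 0) - e k with hθ
  -- the identity `|∇Y|² = F₁/2`
  have hgrad : (fun z : E3 => ‖gradient Y z‖ ^ 2) = fun z => (1 / 2 : ℝ) * sqLapF Y 1 z := by
    funext z
    rw [hYdef, sqLapF_evalE, evalE_sqLapP_one hlap]
    ring
  have hF1d : Differentiable ℝ (sqLapF Y 1) := by
    rw [hYdef, sqLapF_evalE]; exact Zonal.differentiable_evalE _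
  have hθsum : ∀ y : E3, ‖y‖ = r → ∑ k ∈ Finset.range l, θ k * pbr Y (sqLapF Y k) y = 0 := by
    intro y hy
    have hy0 : 0 < ‖y‖ := by rw [hy]; exact hr
    -- (F2) at `x₀ + y`
    have hF2 := orderTwoLawSlice_holds l x₀ Y H p₀ hl1 hY hH hsm hdiv hp y
    rw [hj (x₀ + y), hy] at hF2
    have hbr : strainAmpL l H r ^ 2 * angForm Y y - pbr Y (fun z : E3 => ⟪z, gradient p₀ (x₀ + z)⟫) y = 0 := by
      rcases mul_eq_zero.mp hF2.symm with h0 | h0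
      · exact absurd h0 hK
      · exact h0
    have hstrain : strainAmpL l H r = ampA l h (r ^ 2) := by
      rw [strainAmpL_eq_of_sq l hh hHh hr]; rfl
    have hang : angForm Y y = (1 / 2 : ℝ) * pbr Y (sqLapF Y 1) y := by
      unfold angForm
      rw [hgrad, pbr_const_mul Y (1 / 2 : ℝ) (hF1d y)]
    have hpress := pbr_slicePressure_eq (by omega) hP hlap hh hHh hC x₀ hsm hdiv hp hpoi hdec y
    rw [hy] at hpress
    simp only [hθ, he, sub_mul, Finset.sum_sub_distrib, ite_mul, zero_mul, Finset.sum_ite_eq', Finset.mem_range,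
      show 1 < l by omega, if_true]
    rw [← hpress]
    rw [hstrain, hang] at hbr
    linear_combination hbr
  have key := TwoChannel.coeff_eq_zero hY h2 hr θ hθsum
  simp only [hθ, he, if_true, show (2 : ℕ) ≠ 1 by norm_num, if_false, zero_sub, neg_eq_zero] at key
  exact key

/-- smoothness of the profile away from the apex. -/
theorem contDiffOn_profile_Ioi (hh : ContDiff ℝ ∞ h) (hHh : ∀ r : ℝ, 0 ≤ r → H r = h (r ^ 2)) : ContDiffOn ℝ ∞ H (Ioi 0) :=
  ((hh.comp (contDiff_id.pow 2)).contDiffOn).congr fun r hr => hHh r (le_of_lt hr)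

/-- continuity of the vorticity amplitude away from the apex. -/
theorem continuousOn_vortAmpL (l : ℕ) (hh : ContDiff ℝ ∞ h) (hHh : ∀ r : ℝ, 0 ≤ r → H r = h (r ^ 2)) :
    ContinuousOn (vortAmpL l H) (Ioi 0) := by
  have hd : Continuous (deriv h) := (contDiff_deriv_of_contDiff_top hh).continuous
  have hd2 : Continuous (deriv (deriv h)) := (contDiff_deriv_of_contDiff_top (contDiff_deriv_of_contDiff_top hh)).continuous
  have hc : Continuous fun r : ℝ => 4 * r ^ 2 * deriv (deriv h) (r ^ 2) + (4 * (l : ℝ) + 6) * deriv h (r ^ 2) := by fun_prop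
  exact hc.continuousOn.congr fun r hr => vortAmpL_eq_of_sq l hh hHh hr

/-- a function vanishing on an open interval has zero derivative there. -/
theorem deriv_eq_zero_of_eqOn_zero {φ : ℝ → ℝ} {a b s : ℝ} (hs : s ∈ Ioo a b) (hφ : ∀ x ∈ Ioo a b, φ x = 0) : deriv φ s = 0 := by
  have hev : φ =ᶠ[𝓝 s] fun _ => (0 : ℝ) := by
    filter_upwards [Ioo_mem_nhds hs.1 hs.2] with x hx using hφ x hx
  rw [hev.deriv_eq, deriv_const]

/-- ★ THE KEY ALGEBRA ON AN INTERVAL OF `s`: the two channel equations on an open interval `J′ ⊆ (0,∞)` of the variable `s` force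
`l·ampA² + 2 s·ampA·ampA′ = 0` there (differentiate (E2), use the level-two radial ODE, differentiate the resulting expression of `g₁`,
substitute into (E1): the `g`'s cancel). -/
theorem ampA_ode_of_channels (hl : 3 ≤ l) (hh : ContDiff ℝ ∞ h) (hHh : ∀ r : ℝ, 0 ≤ r → H r = h (r ^ 2))
    (hC : ∀ r : ℝ, 1 ≤ r → r ^ (l + 2) * |H r| ≤ C ∧ r ^ (l + 3) * |deriv H r| ≤ C ∧ r ^ (l + 4) * |deriv (deriv H) r| ≤ C)
    {a b : ℝ} (ha : 0 ≤ a)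
    (hE1 : ∀ s ∈ Ioo a b, ampA l h s ^ 2 / 2 - (2 * s * deriv (cascadeCoeff l h 1) s
        + ((2 * l - 2 * 1 : ℕ) : ℝ) * cascadeCoeff l h 1 s) = 0)
    (hE2 : ∀ s ∈ Ioo a b, 2 * s * deriv (cascadeCoeff l h 2) s + ((2 * l - 2 * 2 : ℕ) : ℝ) * cascadeCoeff l h 2 s = 0)
    {s : ℝ} (hs : s ∈ Ioo a b) :
    (l : ℝ) * ampA l h s ^ 2 + 2 * s * ampA l h s * (((l : ℝ) + 3) * deriv h s + 2 * s * deriv (deriv h) s) = 0 := by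
  have hl1 : 1 ≤ l := by omega
  have hs0 : 0 ≤ s := ha.trans hs.1.le
  set g₁ := cascadeCoeff l h 1 with hg₁
  set g₂ := cascadeCoeff l h 2 with hg₂
  have hg₁c : ContDiff ℝ ∞ g₁ := contDiff_cascadeCoeff (by omega) hh hHh hC (by omega)
  have hg₂c : ContDiff ℝ ∞ g₂ := contDiff_cascadeCoeff (by omega) hh hHh hC (by omega)
  have hg₁d : Differentiable ℝ g₁ := hg₁c.differentiable (by simp)
  have hg₂d : Differentiable ℝ g₂ := hg₂c.differentiable (by simp)
  have hg₁'d : Differentiable ℝ (deriv g₁) := (contDiff_deriv_of_contDiff_top hg₁c).differentiable (by simp)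
  have hg₂'d : Differentiable ℝ (deriv g₂) := (contDiff_deriv_of_contDiff_top hg₂c).differentiable (by simp)
  have hAd := hasDerivAt_ampA hh l s
  have c1 : ((2 * l - 2 * 1 : ℕ) : ℝ) = 2 * l - 2 := by
    rw [Nat.cast_sub (by omega)]; push_cast; ring
  have c2 : ((2 * l - 2 * 2 : ℕ) : ℝ) = 2 * l - 4 := by
    rw [Nat.cast_sub (by omega)]; push_cast; ring
  -- (D2): differentiate (E2)
  have hD2 : 2 * deriv g₂ s + 2 * s * deriv (deriv g₂) s + (2 * (l : ℝ) - 4) * deriv g₂ s = 0 := by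
    have hφ : HasDerivAt (fun x : ℝ => 2 * x * deriv g₂ x + (2 * (l : ℝ) - 4) * g₂ x)
        (2 * deriv g₂ s + 2 * s * deriv (deriv g₂) s + (2 * (l : ℝ) - 4) * deriv g₂ s) s := by
      have h1 : HasDerivAt (fun x : ℝ => 2 * x) 2 s := by simpa using (hasDerivAt_id s).const_mul (2 : ℝ)
      have h2 := (h1.mul (hg₂'d s).hasDerivAt).add ((hg₂d s).hasDerivAt.const_mul (2 * (l : ℝ) - 4))
      exact h2
    have h0 := deriv_eq_zero_of_eqOn_zero (φ := fun x : ℝ => 2 * x * deriv g₂ x + (2 * (l : ℝ) - 4) * g₂ x) hs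
      (fun x hx => by have := hE2 x hx; rwa [c2] at this)
    rw [hφ.deriv] at h0
    exact h0
  -- (O2): the level-two radial ODE
  have hO2 : 4 * s * deriv (deriv g₂) s + (4 * (2 * (l : ℝ) - 4) + 6) * deriv g₂ s
      = -(ampA l h s ^ 2 / 4 + g₁ s) := by
    have := cascadeCoeff_ode_succ hl1 hh hHh hC (k := 1) (by omega) hs0
    rw [c2] at this
    exact this
  -- (G1) as a function identity on the interval, and its derivative (Gd)
  have hG1 : ∀ x ∈ Ioo a b, g₁ x + (4 * (l : ℝ) - 6) * deriv g₂ x + ampA l h x ^ 2 / 4 = 0 := by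
    intro x hx
    have hx0 : 0 ≤ x := ha.trans hx.1.le
    have hD2x : 2 * deriv g₂ x + 2 * x * deriv (deriv g₂) x + (2 * (l : ℝ) - 4) * deriv g₂ x = 0 := by
      have hφ : HasDerivAt (fun x : ℝ => 2 * x * deriv g₂ x + (2 * (l : ℝ) - 4) * g₂ x)
          (2 * deriv g₂ x + 2 * x * deriv (deriv g₂) x + (2 * (l : ℝ) - 4) * deriv g₂ x) x := by
        have h1 : HasDerivAt (fun x : ℝ => 2 * x) 2 x := by simpa using (hasDerivAt_id x).const_mul (2 : ℝ)
        have h2 := (h1.mul (hg₂'d x).hasDerivAt).add ((hg₂d x).hasDerivAt.const_mul (2 * (l : ℝ) - 4))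
        exact h2
      have h0 := deriv_eq_zero_of_eqOn_zero (φ := fun x : ℝ => 2 * x * deriv g₂ x + (2 * (l : ℝ) - 4) * g₂ x) hx
        (fun x hx => by have := hE2 x hx; rwa [c2] at this)
      rw [hφ.deriv] at h0
      exact h0
    have hO2x : 4 * x * deriv (deriv g₂) x + (4 * (2 * (l : ℝ) - 4) + 6) * deriv g₂ x
        = -(ampA l h x ^ 2 / 4 + g₁ x) := by
      have := cascadeCoeff_ode_succ hl1 hh hHh hC (k := 1) (by omega) hx0
      rw [c2] at this
      exact this
    linear_combination hO2x - 2 * hD2x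
  have hGd : deriv g₁ s + (4 * (l : ℝ) - 6) * deriv (deriv g₂) s
      + ampA l h s * (((l : ℝ) + 3) * deriv h s + 2 * s * deriv (deriv h) s) / 2 = 0 := by
    have hφ : HasDerivAt (fun x : ℝ => g₁ x + (4 * (l : ℝ) - 6) * deriv g₂ x + ampA l h x ^ 2 / 4)
        (deriv g₁ s + (4 * (l : ℝ) - 6) * deriv (deriv g₂) s
          + ampA l h s * (((l : ℝ) + 3) * deriv h s + 2 * s * deriv (deriv h) s) / 2) s := by
      have h3 : HasDerivAt (fun x : ℝ => ampA l h x ^ 2 / 4)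
          (ampA l h s * (((l : ℝ) + 3) * deriv h s + 2 * s * deriv (deriv h) s) / 2) s := by
        have := (hAd.pow 2).div_const 4
        exact this.congr_deriv (by ring)
      exact ((hg₁d s).hasDerivAt.add ((hg₂'d s).hasDerivAt.const_mul _)).add h3
    have h0 := deriv_eq_zero_of_eqOn_zero (φ := fun x : ℝ => g₁ x + (4 * (l : ℝ) - 6) * deriv g₂ x + ampA l h x ^ 2 / 4) hs hG1
    rw [hφ.deriv] at h0
    exact h0
  have hE1s := hE1 s hs
  rw [c1] at hE1s
  linear_combination 2 * hE1s + 4 * s * hGd + (4 * (l : ℝ) - 4) * hO2 - (16 * (l : ℝ) - 20) * hD2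

end Rigidity

end Summit.NavierStokesRegularity.NavierStokesRegularity.Theorems.UnthreadedRigidity.VirialHorn
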